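import Literature.AlgebraicGeometry.Shioda1982.ExceptionalQuadruplesComplete
import HarnessLib

/-!
# Shioda 1982 / Meyer–Neutsch 1981: no exceptional quadruple at the level `N = 630` — kernel sweep, part 9 of 24

Topic `Literature/AlgebraicGeometry/Shioda1982`; companion of `ExceptionalQuadruplesComplete.lean` (search `checkB`, soundness
`tabelleOneCompleteAt_of_chunks`, invariant form `exists_mem_reps_of_isExceptionalQuadruple`, statement `TabelleOneCompleteAt`; sources,
method and framing in its module docstring) and of the series `ExceptionalQuadruplesSweep*.lean` (together: every level `2 ≤ N ≤ 180`
that is not a row of Tabelle 1; `…SweepTwoHundredTwenty/…TwoHundredSixty/…ThreeHundredForty.lean`,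
`…SweepTwoHundredFiftyTwo/…ThreeHundredNinetySix/…FourHundredSixtyEight.lean`, `…SweepTwoHundred.lean`: the levels `220, 260, 340`, `252, 396, 468`
and `200` of the families `20p`, `36p`, `40p`; `…Sweep<Level>[Part<K>].lean` for the `{2,3,5,7}`-smooth residual levels
`189, 192, 210, 216, 224, 240, 270, 288, 300, 315, 320, 324, 336, 360, 378, 384, 405, 420, 432, 448` and now `480 … 630`). THEOREMS only (no definition, no named fact): the same kernel
search at the single level `N = 630`, which carries NO row of [MeyerNeutsch1981Fermatquadrupel, Tabelle 1] (computer-generated there,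
"alle Fermatquadrupel für N ≤ 614 ermittelt", §2 p. 53) and lies above the range `N ≤ 180` of Shioda's table p. 727 — by Aoki's
Theorem C ([Aoki1983], computer-assisted for `181 ≤ m ≤ 672`) there is no exceptional element at any level `> 180`; the files
`ExceptionalQuadruplesSweepSixHundredThirtyPartOne.lean`, `ExceptionalQuadruplesSweepSixHundredThirtyPartTwo.lean`, `ExceptionalQuadruplesSweepSixHundredThirtyPartThree.lean`, `ExceptionalQuadruplesSweepSixHundredThirtyPartFour.lean`, `ExceptionalQuadruplesSweepSixHundredThirtyPartFive.lean`, `ExceptionalQuadruplesSweepSixHundredThirtyPartSix.lean`, `ExceptionalQuadruplesSweepSixHundredThirtyPartSeven.lean`, `ExceptionalQuadruplesSweepSixHundredThirtyPartEight.lean`, `ExceptionalQuadruplesSweepSixHundredThirtyPartNine.lean`, `ExceptionalQuadruplesSweepSixHundredThirtyPartTen.lean`, `ExceptionalQuadruplesSweepSixHundredThirtyPartEleven.lean`, `ExceptionalQuadruplesSweepSixHundredThirtyPartTwelve.lean`, `ExceptionalQuadruplesSweepSixHundredThirtyPartThirteen.lean`, `ExceptionalQuadruplesSweepSixHundredThirtyPartFourteen.lean`,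 `ExceptionalQuadruplesSweepSixHundredThirtyPartFifteen.lean`, `ExceptionalQuadruplesSweepSixHundredThirtyPartSixteen.lean`, `ExceptionalQuadruplesSweepSixHundredThirtyPartSeventeen.lean`, `ExceptionalQuadruplesSweepSixHundredThirtyPartEighteen.lean`, `ExceptionalQuadruplesSweepSixHundredThirtyPartNineteen.lean`, `ExceptionalQuadruplesSweepSixHundredThirtyPartTwenty.lean`, `ExceptionalQuadruplesSweepSixHundredThirtyPartTwentyOne.lean`, `ExceptionalQuadruplesSweepSixHundredThirtyPartTwentyTwo.lean`, `ExceptionalQuadruplesSweepSixHundredThirtyPartTwentyThree.lean`, `ExceptionalQuadruplesSweepSixHundredThirty.lean` make the instance `N = 630` a kernel statement. The search at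
`N = 630` visits 6995415 candidate triples (`φ(630) − 1 = 143` units each), too many for one elaboration of bounded wall time, so the
chunks of first entries are spread over 24 files: `ExceptionalQuadruplesSweepSixHundredThirtyPartOne.lean` — first entries `0 ≤ a < 8` (267439 candidates);
`ExceptionalQuadruplesSweepSixHundredThirtyPartTwo.lean` — first entries `8 ≤ a < 17` (307879 candidates);
`ExceptionalQuadruplesSweepSixHundredThirtyPartThree.lean` — first entries `17 ≤ a < 25` (278863 candidates);
`ExceptionalQuadruplesSweepSixHundredThirtyPartFour.lean` — first entries `25 ≤ a < 33` (282772 candidates);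
`ExceptionalQuadruplesSweepSixHundredThirtyPartFive.lean` — first entries `33 ≤ a < 41` (285743 candidates);
`ExceptionalQuadruplesSweepSixHundredThirtyPartSix.lean` — first entries `41 ≤ a < 50` (323843 candidates);
`ExceptionalQuadruplesSweepSixHundredThirtyPartSeven.lean` — first entries `50 ≤ a < 58` (288939 candidates);
`ExceptionalQuadruplesSweepSixHundredThirtyPartEight.lean` — first entries `58 ≤ a < 66` (288976 candidates);
`ExceptionalQuadruplesSweepSixHundredThirtyPartNine.lean` — first entries `66 ≤ a < 74` (288075 candidates);
`ExceptionalQuadruplesSweepSixHundredThirtyPartTen.lean` — first entries `74 ≤ a < 82` (286235 candidates);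
`ExceptionalQuadruplesSweepSixHundredThirtyPartEleven.lean` — first entries `82 ≤ a < 90` (283456 candidates);
`ExceptionalQuadruplesSweepSixHundredThirtyPartTwelve.lean` — first entries `90 ≤ a < 99` (314398 candidates);
`ExceptionalQuadruplesSweepSixHundredThirtyPartThirteen.lean` — first entries `99 ≤ a < 107` (274435 candidates);
`ExceptionalQuadruplesSweepSixHundredThirtyPartFourteen.lean` — first entries `107 ≤ a < 116` (301865 candidates);
`ExceptionalQuadruplesSweepSixHundredThirtyPartFifteen.lean` — first entries `116 ≤ a < 125` (293299 candidates);
`ExceptionalQuadruplesSweepSixHundredThirtyPartSixteen.lean` — first entries `125 ≤ a < 134` (283397 candidates);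
`ExceptionalQuadruplesSweepSixHundredThirtyPartSeventeen.lean` — first entries `134 ≤ a < 144` (301646 candidates);
`ExceptionalQuadruplesSweepSixHundredThirtyPartEighteen.lean` — first entries `144 ≤ a < 154` (285938 candidates);
`ExceptionalQuadruplesSweepSixHundredThirtyPartNineteen.lean` — first entries `154 ≤ a < 165` (294200 candidates);
`ExceptionalQuadruplesSweepSixHundredThirtyPartTwenty.lean` — first entries `165 ≤ a < 177` (293871 candidates);
`ExceptionalQuadruplesSweepSixHundredThirtyPartTwentyOne.lean` — first entries `177 ≤ a < 190` (282904 candidates);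
`ExceptionalQuadruplesSweepSixHundredThirtyPartTwentyTwo.lean` — first entries `190 ≤ a < 206` (291755 candidates);
`ExceptionalQuadruplesSweepSixHundredThirtyPartTwentyThree.lean` — first entries `206 ≤ a < 229` (300296 candidates);
`ExceptionalQuadruplesSweepSixHundredThirty.lean` — first entries `229 ≤ a < 630` (295191 candidates); the last one assembles
`completeAt_sixHundredThirty` (every sorted pair-free primitive Hodge 4-multiset mod `630` is standard) and `not_isExceptionalQuadruple_sixHundredThirty`.
WHY THIS LEVEL (cell `pub-hfermat`): `630 = 2·3²·5·7`: the tree's character-sum families cover the levels `K·p`, `p` a prime above a bound depending on `K`, for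
`K ∈ {2, 3, 4, 6, 8, 9, 10, 12, 18, 20, 24, 36, 40}` or `K` a power of `2` or of `3` (`PicardNumber<K>Prime.lean`, `PicardNumberTwoPowerPrime.lean`,
`PicardNumberThreePowPrime.lean`) and the prime-power levels (`PicardNumberPrimePower.lean`); writing `630 = K·p` with `p` prime forces
`K ∈ {90, 126, 210, 315}`, none of them among those `K`. `decide +kernel` only (no `native_decide`).

HONEST FRAMING (cell `pub-hfermat`): explicit algebraic cycles for specific Hodge classes on Fermat/Delsarte varieties; residual open
instances listed; no claim on general Hodge. These classes are algebraic (Lefschetz (1,1)); certified here is only the emptiness of the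
exceptional list at this level.

## References
* [MeyerNeutsch1981Fermatquadrupel] W. Meyer, W. Neutsch, *Fermatquadrupel*, Math. Ann. 256 (1981) 51–62, §2 p. 53, Tabelle 1 p. 54 (no row 630).
* [Shioda1982PicardFermat] T. Shioda, J. Fac. Sci. Univ. Tokyo IA 28 (1982) 725–734, table p. 727 (levels `≤ 180`), Prop. 4 (Q′) p. 729.
* [Aoki1983] N. Aoki, Math. Ann. 266 (1983) 23–54, Thm. C.
-/

namespace Literature.AlgebraicGeometry.Shioda1982

open Literature.AlgebraicGeometry.HodgeTheory

set_option maxHeartbeats 0 in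
/-- **The search at `N = 630` passes on the first entries `66 ≤ a < 74`** (part 9 of 24: 8 chunks, 288075 candidate
triples): every visited sorted quadruple of representatives there fails the Hodge test or is standard (`checkB`; `reps 630 = []`).
[cite: MeyerNeutsch1981Fermatquadrupel, §2 p. 53 ("alle Fermatquadrupel für N ≤ 614 ermittelt") and Tabelle 1 p. 54 (no row 630)]
[cite: Aoki1983, Thm. C] -/
theorem checkB_sixHundredThirty_partNine :
    ∀ p ∈ ([(66, 1), (67, 1), (68, 1), (69, 1), (70, 1), (71, 1), (72, 1), (73, 1)] : List (ℕ × ℕ)), checkB 630 p.1 p.2 = true := by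
  intro p hp
  simp only [List.mem_cons, List.not_mem_nil, or_false] at hp
  rcases hp with rfl | rfl | rfl | rfl | rfl | rfl | rfl | rfl <;> decide +kernel

end Literature.AlgebraicGeometry.Shioda1982
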